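import Mathlib
import Summits.PneNP.PneNP.Theorems.OneSliceSliceTargetSplit

/-!
# Route OneSlice — item `SliceTargetOfContinuation` (stmt-PneNP-18972)

The glue of the split `SliceTarget ⟸ MonotoneContinuation ∧ SingleThreshold` of crux `SliceTarget`
(stmt-PneNP-2832, line `monotone-continuation-split`): the route decl
`OneSlice.SliceTargetOfContinuation := MonotoneContinuation → SingleThreshold → SliceTarget`
is exactly the assembly theorem
`SliceTargetSplit.sliceTarget_of_monotoneContinuation_of_singleThreshold`
(parts I–III: `OneSliceSliceTargetSplitTransport`, `OneSliceSliceTargetSplitStability`,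
`OneSliceSliceTargetSplit`).
-/

set_option linter.dupNamespace false -- `Summit.PneNP.PneNP.…`: summit = sub-problem (D-0017)

namespace Summit.PneNP.PneNP.Theorems

/-- **Item `SliceTargetOfContinuation` (stmt-PneNP-18972), proved**: `MonotoneContinuation → SingleThreshold →
SliceTarget`. Fix `c`; `MonotoneContinuation` gives `c'`; `SingleThreshold` at `c'` gives `(k ≥ 3, δ_S)`;
`MonotoneContinuation` at `(k, η := δ_S/3)` gives `ε`; with `δ := min (ε/2) (δ_S/3)`, a `δ`-slice-accurate monotone
`C` with `|C| ≤ n^c` has its slice transport `2δ ≤ ε`-close to the monotone `CLIQUE_k` (contraction + stability), so it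
continues to a monotone `C'` with `|C'| ≤ n^{c'}` and `G(n,p_c)`-error `≤ δ_S`, contradicting `SingleThreshold`.
[folklore] -/
theorem sliceTargetOfContinuation_proof : Summit.PneNP.PneNP.Theses.OneSlice.SliceTargetOfContinuation := by
  unfold Summit.PneNP.PneNP.Theses.OneSlice.SliceTargetOfContinuation
  exact SliceTargetSplit.sliceTarget_of_monotoneContinuation_of_singleThreshold

end Summit.PneNP.PneNP.Theorems
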